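import Summits.ABC.IUTFork.LanaProcedure
import Summits.ABC.IUTFork.LanaEtaRealKappa
import Summits.ABC.IUTFork.LanaRealHull
import HarnessLib

/-!
# L-LANA objects XIII bis: the §8.1 procedure assembled over the REAL pieces — what is left to assume (LANA §8.1, §9)

Record-only file (D-0012) of the abc-iut cell (seat abc-iut-c312-4, L-LANA level; assembly of the gen-2
realisations into gen-0's `LanaProcedure`); TAKES NO SIDE on [IUTchIII] Cor. 3.12. Gen-0's `LanaProcedure`
(§8.1 (a)–(i) on the big-H diagram) carries two HYPOTHESIS fields — the p. 36 containment at each place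
(`containment`, Thm. 3.11 (ii) content) and "every output region lies in the hull" (`suitableInHull`, §8.1 (f))
— over abstract `EtaSteps` and an abstract `EtaData`. With the gen-2 files, the local Kummer side of each
`EtaSteps` is REAL (`EtaThetaSide.toEtaSteps`, `LanaEtaRealKappa`), the container, `q`-region and hull are REAL
(`RealHullInput.etaData` over `(⊕_j K_j, μ_Λ)`, `LanaRealHull`) and `suitableInHull` is a THEOREM. THIS FILE
assembles them:

* `LanaProcedureRealInput` ↦ `toProcedure : LanaProcedure ref bad μ_Λ` — from a big-H diagram, an
  `EtaThetaSide` at each place WITH its containment hypothesis, and a `RealHullInput`; the field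
  `suitableInHull` is filled by the theorem `RealHullInput.suitableInHull`;
* `factors` — §9.1 (f) "`ψ_v` factors through `∏_t O^▷_{v,t}`" at every place whose label fields are torally
  Kummer-faithful (gen-0 `factors_of_injective` with `hκ` DISCHARGED, `LanaKummerTowerInjective`);
* `cor312_of_mainGoal`, `hypotheses_census` — over the assembled REAL data, (8-1) follows from (9-1), and the
  inputs that remain HYPOTHESES are exactly: (1) the containment at each place ([IUTchIII] Thm. 3.11 (ii) as read
  by LANA p. 36), (2) (9-1) itself; everything else (BPS/Θ-link gluing, Kummer maps and their injectivity,
  log-shell `(HF)`, container, hull, `SuitableInHull`, monotonicity) is constructed or proved in the tree. The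
  DATA that remain inputs: the étale theta side of Fig. 3 (Steps 2–5, 7), the possible images `⋃_λ U_λ` with
  `LGP`, `Suitable` ((Ind1–3)) — i.e. the OUTPUT of Thm. 3.11's algorithm, typed by c312-1/L6.

[cite: LANA2026Report, §8.1 (a)–(i) pp. 40–41, §9.1 (f) p. 45, §9.2 (9-1) p. 46] NOT here: any judgement.
-/

noncomputable section

open MeasureTheory Set Metric Bornology
open Literature.IUT.LogVolume

namespace Summit.ABC
namespace IUTFork

open Literature.AnabelianGeometry.AbsoluteAnabelian.AbsTopIII (IsTorallyKummerFaithful)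

variable {V : Type} (ref : V → RefLocalDatum) [Fintype V] (bad : Finset V)
  {J : Type} [Fintype J] (K : J → Type) [∀ j, NontriviallyNormedField (K j)]
  [MeasurableSpace (Π j, K j)] [BorelSpace (Π j, K j)] (Λ : IntegralStructure (Π j, K j))
  [∀ j, ProperSpace (K j)] [∀ j, IsUltrametricDist (K j)]

/-- **Input for the §8.1 procedure over the REAL pieces**: (b),(d),(g) a big-H diagram; (c) at each place the
Fig. 3 data with REAL local Kummer side (`EtaThetaSide`) and — HYPOTHESIS — the p. 36 containment for it;
(a),(e),(f),(h) a `RealHullInput` in the real container `(⊕_j K_j, μ_Λ)`. [cite: LANA2026Report, §8.1 pp. 40–41] -/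
structure LanaProcedureRealInput : Type 1 where
  /-- (b),(d),(g): two log sequences and a Θ-link at every level -/
  bigH : BigH ref bad
  /-- (c): the Fig. 3 data at each place, local Kummer side real -/
  eta : V → EtaThetaSide
  /-- (c), HYPOTHESIS: the p. 36 containment `Im ψ_v ⊆ Im φ_v` at each place -/
  containment : ∀ v, (eta v).toEtaSteps.Containment
  /-- (a),(e),(f),(h): the real `η`-datum input (q-element, output map, suitable `S`, possible images) -/
  hull : RealHullInput K Λ

namespace LanaProcedureRealInput

variable {ref bad K Λ} (I : LanaProcedureRealInput ref bad K Λ)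

/-- **The assembled §8.1 procedure** (gen-0 `LanaProcedure`) — `suitableInHull` is no longer an input: it is
`RealHullInput.suitableInHull`. [cite: LANA2026Report, §8.1 pp. 40–41] -/
def toProcedure : LanaProcedure ref bad Λ.haar where
  bigH := I.bigH
  eta v := (I.eta v).toEtaSteps
  containment := I.containment
  E := I.hull.etaData
  suitableInHull := I.hull.suitableInHull

/-- The procedure's `η`-datum is the real one. [cite: LANA2026Report, §9.2 p. 46] -/
@[simp] theorem toProcedure_E : I.toProcedure.E = I.hull.etaData := rfl

/-- The procedure's local Kummer maps are the constructed ones. [cite: LANA2026Report, §6.2 (g) p. 35] -/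
theorem toProcedure_kappa (v : V) (t : (I.eta v).T) :
    (I.toProcedure.eta v).kappa t = AlgCl.kummerTowerInt ((I.eta v).K t) := rfl

/-- **§9.1 (f) at every place with torally Kummer-faithful label fields**: `ψ_v` factors (uniquely) through
`∏_t O^▷_{v,t}` — gen-0 `factors_of_injective` with `hκ` DISCHARGED. [cite: LANA2026Report, §9.1 (f) p. 45] -/
theorem factors (v : V) (hK : ∀ t, IsTorallyKummerFaithful ((I.eta v).K t)) : (I.toProcedure.eta v).Factors :=
  I.toProcedure.factors_of_injective v fun t => AlgCl.kummerTowerInt_injective_of ((I.eta v).K t) (hK t)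

/-- `−|log(Θ)|` of the assembled procedure is S2's log-volume of the REAL hull of `⋃_λ U_λ`.
[cite: LANA2026Report, §8.1 (h) p. 41] -/
theorem negAbsLogTheta_eq : I.toProcedure.negAbsLogTheta = Λ.logVolume (holomorphicHull K I.hull.images) := rfl

/-- `−|log(q)|` of the assembled procedure is S2's log-volume of `q·O_L`. [cite: LANA2026Report, §8.1 (a) p. 40] -/
theorem negAbsLogq_eq : I.toProcedure.negAbsLogq = Λ.logVolume (hullSet K I.hull.q) := rfl

/-- **(9-1) ⟹ (8-1) over the assembled REAL data**: `log μ_Λ(q·O_L) ≤ log μ_Λ((⋃_λ U_λ)^{hol})`.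
[cite: LANA2026Report, §9 p. 44, §8.3 p. 43] -/
theorem cor312_of_mainGoal (h : I.toProcedure.MainGoal) :
    Λ.logVolume (hullSet K I.hull.q) ≤ Λ.logVolume (holomorphicHull K I.hull.images) :=
  I.toProcedure.cor312_of_mainGoal h

/-- **CENSUS of what remains assumed** (the typed form of LANA §8.1 (i) / §9 over real objects): granted the
containment at each place (a field of the input, Thm. 3.11 (ii) content) — (8-1) follows from (9-1), (9-1) is
equivalent to skel VIII's `Represented`, and at torally Kummer-faithful places `ψ_v` factors through
`∏_t O^▷_{v,t}`. Nothing else is hypothesised: the hull inclusion, the Kummer injectivity and the volume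
monotonicity are theorems. [cite: LANA2026Report, §8.1 (i) p. 41, §8.3 p. 43, §9.2 (9-1) p. 46] -/
theorem hypotheses_census (hK : ∀ v t, IsTorallyKummerFaithful ((I.eta v).K t)) :
    (I.toProcedure.MainGoal → I.toProcedure.Cor312) ∧
      (I.toProcedure.MainGoal ↔ (I.hull.etaData.toOutputRegions I.hull.suitableInHull).Represented) ∧
      (∀ v, (I.toProcedure.eta v).Factors) :=
  ⟨I.toProcedure.cor312_of_mainGoal, I.toProcedure.mainGoal_iff_represented, fun v => I.factors v (hK v)⟩

/-- (9-1) remains genuinely open at this level: with no suitable `S` it fails (vacuity check, unchanged).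
[cite: LANA2026Report, Rem. 8.2.1 p. 42, §10.5 p. 49] -/
theorem not_mainGoal_of_suitable_empty (h : I.hull.Suitable = ∅) : ¬ I.toProcedure.MainGoal :=
  I.hull.not_mainGoal_of_suitable_empty h

end LanaProcedureRealInput

end IUTFork

end Summit.ABC

end
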